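import Mathlib
import HarnessLib
import Summits.QuantumFields.Statement

/-!
# Sketch — crux-ideate stmt-QuantumFields-9151 (PhaseQuenchedFlavourDecay), ideator 2, round 1

First lemmas / transfer targets of the two idea cards (must only ELABORATE; nothing here is proved):

* card `crossing-split-integrability`: `SplitBound` (abstract Hölder/Chebyshev splitting, provable now) and the
  transfer target `AprioriMinorIntegrability` (volume-uniform phase-quenched `(1+ε)`-moments of Wick minors).
* card `impurity-free-energy-minors`: `CubeDomination` (complementary minors ≤ cube-average of `|det(D + Γ K)|` over
  local Hermitian sources, pure algebra, provable now) and the transfer target `PQWegnerPlus` (depletion of the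
  phase-quenched local density of states of the Hermitian Wilson–Dirac operator at zero, locally uniform under local
  Hermitian sources).
-/

namespace Summit.QuantumFields.QCD.Cruxes.PhaseQuenchedFlavourDecay.Ideator2

open scoped BigOperators
open MeasureTheory Filter

/-- Card A, first lemma (abstract; provable now from Hölder + Markov). On a probability space, a non-negative `X`
(the Wick minor) which is `≤ η^q · Y` off the event `{G > η}` (`G` = largest crossing entry, `q` = flavour charge)
obeys `E X ≤ ‖X‖_{1+ε} ν(G>η)^{ε/(1+ε)} + η^{qε/(1+2ε)} (E√Y)^{2ε/(1+2ε)} (E X^{1+ε})^{1/(1+2ε)}`. -/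
def SplitBound : Prop :=
  ∀ (Ω : Type) [MeasurableSpace Ω] (ν : Measure Ω) [IsProbabilityMeasure ν] (X Y G : Ω → ℝ) (ε η : ℝ) (q : ℕ),
    0 < ε → 0 < η → η ≤ 1 → (∀ ω, 0 ≤ X ω) → (∀ ω, 0 ≤ Y ω) → Measurable X → Measurable Y → Measurable G →
    Integrable (fun ω => X ω ^ (1 + ε)) ν → Integrable (fun ω => Real.sqrt (Y ω)) ν →
    (∀ ω, G ω ≤ η → X ω ≤ η ^ q * Y ω) →
      ∫ ω, X ω ∂ν ≤
        (∫ ω, X ω ^ (1 + ε) ∂ν) ^ (1 / (1 + ε)) * (ν {ω | η < G ω}).toReal ^ (ε / (1 + ε)) +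
          η ^ ((q : ℝ) * ε / (1 + 2 * ε)) * (∫ ω, Real.sqrt (Y ω) ∂ν) ^ (2 * ε / (1 + 2 * ε)) *
            (∫ ω, X ω ^ (1 + ε) ∂ν) ^ (1 / (1 + 2 * ε))

/-- Card A, transfer target `C⁺` (with UPPER it implies the crux by `SplitBound` + Wick/charge bookkeeping):
volume-uniform phase-quenched `(1+ε)`-th moments of the `r × r` Wick minors of the flavour-`f` quark propagator whose
row/column quark variables sit in the two boxes of radius `R` around `0` and around `n e₀` (no decay claimed, no
charge condition; ONE `ε` for all `r`, `R`). -/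
def AprioriMinorIntegrability : Prop :=
  open Literature.MathematicalPhysics.QuantumFieldTheory Literature.MathematicalPhysics.QuantumLattice
    Literature.Probability.LatticeModels in
  ∀ (Nf : ℕ) (reg : QCDRegularisation Nf) (m : Fin Nf → ℝ), (∀ f, 0 < m f) →
    ∃ ε : ℝ, 0 < ε ∧ ∀ (f : Fin Nf) (r R : ℕ), ∃ C : ℝ, ∀ᶠ k in atTop, ∀ S : ℕ, reg.L k ≤ S → ∀ n : ℕ, n ≤ S →
      ∀ (row col : Fin r → Bool × ↥(box 4 R) × Fin 3 × Fin 4),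
        let mq : Fin Nf → ℝ := fun fl => reg.mcrit k + reg.a k * m fl / reg.Zm k
        let site : Bool × ↥(box 4 R) × Fin 3 × Fin 4 → TorusSite 4 (2 * S + 1) × Fin 3 × Fin 4 := fun p =>
          (Torus.proj (2 * S + 1)
            ((p.2.1 : Literature.Probability.LatticeModels.Site 4) + if p.1 then Pi.single 0 (n : ℤ) else 0), p.2.2)
        (∫ U : GaugeConfig 4 (2 * S + 1) (Matrix.specialUnitaryGroup (Fin 3) ℂ),
            ‖(diracMatrix U mq).det‖ *
              ‖(Matrix.of fun a b : Fin r =>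
                  (diracMatrix U mq)⁻¹ (quarkEquiv (f, site (col b))) (quarkEquiv (f, site (row a)))).det‖ ^ (1 + ε)
            ∂(wilsonMeasure (fundamentalRep (Fin 3)) (reg.β k))) /
          (∫ U : GaugeConfig 4 (2 * S + 1) (Matrix.specialUnitaryGroup (Fin 3) ℂ),
            ‖(diracMatrix U mq).det‖ ∂(wilsonMeasure (fundamentalRep (Fin 3)) (reg.β k))) ≤ C

/-- Card B, first lemma (pure algebra, provable now by multilinearity + finite-dimensional norm equivalence):
every complementary minor of an `N × N` complex matrix `D` with the deleted rows `I` and columns `J` inside the image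
of `e : Fin q ↪ Fin N` is bounded by `C(q,r)` times the average of `|det(D + Γ K)|` over the unit cube of Hermitian
sources `K` supported on that image (`Γ` any diagonal `±1` matrix, e.g. `Γ₅`) — uniformly in `N`, `D`, `Γ`, `e`. -/
def CubeDomination : Prop :=
  ∀ q r : ℕ, ∃ C : ℝ, 0 ≤ C ∧ ∀ (N : ℕ) (D : Matrix (Fin N) (Fin N) ℂ) (γ : Fin N → ℂ),
    (∀ i, γ i = 1 ∨ γ i = -1) → ∀ (e : Fin q ↪ Fin N) (I J : Finset (Fin N)),
      I ⊆ Finset.univ.map e → J ⊆ Finset.univ.map e → ∀ (hI : Iᶜ.card = N - r) (hJ : Jᶜ.card = N - r),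
        I.card = r → J.card = r →
          ‖(D.submatrix (Iᶜ.orderEmbOfFin hI) (Jᶜ.orderEmbOfFin hJ)).det‖ ≤
            C * ∫ c in Set.Icc (-1 : Fin q → Fin q → ℝ) 1,
              ‖(D + Matrix.diagonal γ *
                  ∑ a : Fin q, ∑ b : Fin q, (c a b : ℂ) •
                    (if a ≤ b then Matrix.single (e a) (e b) (1 : ℂ) + Matrix.single (e b) (e a) 1
                      else Complex.I • (Matrix.single (e a) (e b) (1 : ℂ) - Matrix.single (e b) (e a) 1))).det‖

/-- Card B, transfer target (PQ-Wegner₊): along the bare trajectory, the PHASE-QUENCHED expectation of the local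
spectral weight of the Hermitian Wilson–Dirac operator `H_f = Γ₅ D_W(m_f(k))` at zero, smeared at scale `η`
(`∑_{a,α} Im (H_f + K − iη)⁻¹((x,a,α),(x,a,α)) = ∑_i w_i(x) η/(λ_i² + η²)`), vanishes like `η^ε` — uniformly in the
volume `S ≥ L_k`, the site `x`, and a Hermitian source `K` of cube-size `1` supported at `x` (the weight is deformed
consistently: `|det(D_f + Γ₅K)| = |det(H_f + K)|`). Exponent `1 + ε` for the window count; `ε = 1` expected. -/
def PQWegnerPlus : Prop :=
  open Literature.MathematicalPhysics.QuantumFieldTheory Literature.MathematicalPhysics.QuantumLattice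
    Literature.Probability.LatticeModels in
  ∀ (Nf : ℕ) (reg : QCDRegularisation Nf) (m : Fin Nf → ℝ), (∀ f, 0 < m f) →
    ∃ ε C : ℝ, 0 < ε ∧ 0 < C ∧ ∀ᶠ k in atTop, ∀ S : ℕ, reg.L k ≤ S →
      ∀ (f : Fin Nf) (x : TorusSite 4 (2 * S + 1)) (c : Fin (3 * 4) → Fin (3 * 4) → ℝ), c ∈ Set.Icc (-1) 1 →
        ∀ η : ℝ, 0 < η → η ≤ 1 →
          let mq : Fin Nf → ℝ := fun fl => reg.mcrit k + reg.a k * m fl / reg.Zm k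
          let DW : Fin Nf → GaugeConfig 4 (2 * S + 1) (Matrix.specialUnitaryGroup (Fin 3) ℂ) →
              Matrix (TorusSite 4 (2 * S + 1) × Fin 3 × Fin 4) (TorusSite 4 (2 * S + 1) × Fin 3 × Fin 4) ℂ :=
            fun fl U => wilsonDirac (fundamentalRep (Fin 3)) U (mq fl) 1
          let K : Matrix (TorusSite 4 (2 * S + 1) × Fin 3 × Fin 4) (TorusSite 4 (2 * S + 1) × Fin 3 × Fin 4) ℂ :=
            ∑ p : Fin (3 * 4), ∑ p' : Fin (3 * 4), (c p p' : ℂ) •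
              (if p ≤ p' then
                  Matrix.single (x, finProdFinEquiv.symm p) (x, finProdFinEquiv.symm p') (1 : ℂ) +
                    Matrix.single (x, finProdFinEquiv.symm p') (x, finProdFinEquiv.symm p) 1
                else Complex.I • (Matrix.single (x, finProdFinEquiv.symm p) (x, finProdFinEquiv.symm p') (1 : ℂ) -
                    Matrix.single (x, finProdFinEquiv.symm p') (x, finProdFinEquiv.symm p) 1))
          let Γ : Matrix (TorusSite 4 (2 * S + 1) × Fin 3 × Fin 4) (TorusSite 4 (2 * S + 1) × Fin 3 × Fin 4) ℂ :=
            spinorLift gammaFive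
          let w : GaugeConfig 4 (2 * S + 1) (Matrix.specialUnitaryGroup (Fin 3) ℂ) → ℝ := fun U =>
            ∏ fl : Fin Nf, if fl = f then ‖(DW fl U + Γ * K).det‖ else ‖(DW fl U).det‖
          (∫ U, w U * (∑ a : Fin 3, ∑ α : Fin 4,
                (((Γ * DW f U + K -
                    ((η : ℂ) * Complex.I) •
                      (1 : Matrix (TorusSite 4 (2 * S + 1) × Fin 3 × Fin 4) (TorusSite 4 (2 * S + 1) × Fin 3 × Fin 4) ℂ))⁻¹ :
                    Matrix (TorusSite 4 (2 * S + 1) × Fin 3 × Fin 4) (TorusSite 4 (2 * S + 1) × Fin 3 × Fin 4) ℂ)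
                  (x, a, α) (x, a, α)).im)
              ∂(wilsonMeasure (fundamentalRep (Fin 3)) (reg.β k))) /
            (∫ U, w U ∂(wilsonMeasure (fundamentalRep (Fin 3)) (reg.β k))) ≤ C * η ^ ε

end Summit.QuantumFields.QCD.Cruxes.PhaseQuenchedFlavourDecay.Ideator2
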